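import Literature.NumberTheory.EllipticCurves.BinaryQuarticRealTypesProofs
import HarnessLib

/-!
# Bhargava–Shankar, eq. (31): finiteness of the class counts (from Thm 2.1) and
# `N(S^F; 2¹⁰·27·X) = Σ_{H(E_{A,B}) < X} #{PGL₂(ℚ)-classes with invariants 2⁴I(E), 2⁶J(E)}`

`Proofs` companion of `BhargavaShankarLocalMasses.lean` (theorems only): the bookkeeping that
identifies the count `N(S^F; 2¹²X')` of the source (held arXiv text `arXiv:1006.1002v2`, §5.4,
p. 34: "the numerator of the left hand side of [Thm 5.14] is equal to `N(S^F; 2¹²X)`", a sum over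
the curves `E ∈ F` with `H'(E) < X'` of the number of `PGL₂(ℚ)`-classes of locally soluble
irreducible integral quartics with invariants `2⁴I(E)`, `2⁶J(E)`) with the sum appearing in the
tree's rendering of eq. (31), `bhargavaShankar_sum_irredClassCount_asymptotic` (indexed by
`heightFamilyBelow X`, `H(E) < X`, so that `2¹²X' = 2¹²·(27/4)X = 2¹⁰·27·X`).

## Contents (all proved)

* `finite_orbits_of_asymptotic`, `finite_orbits_of_classCount`: an asymptotic
  `N(S; X) = c X^{5/6} + O(X^{a})` with `c > 0`, `a < 5/6` — as provided for `V_ℤ^{(0)}`,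
  `V_ℤ^{(1)}`, `V_ℤ^{(2)}` by Thm 2.1 (`bhargavaShankar_classCount`) — forces the orbit sets
  `{GL₂(ℤ)f : f ∈ S irreducible, H(f) < X}` to be finite for every `X` (they increase with `X`,
  and an infinite one would make `N(S; ·)` vanish identically from there on).
* `sum_pgl2QClassCount_eq_locSolIrredClassCount`: granted Thm 2.1 (for finiteness),
  `Σ_{(A,B) ∈ heightFamilyBelow X} #{PGL₂(ℚ)-classes of loc. sol. irreducible f with
  I(f) = 2⁴(−3A), J(f) = 2⁶(−27B)} = N(S^F; 2¹⁰·27·X)` (`locSolIrredClassCount`): the set counted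
  on the right is the disjoint union over `(A,B)` of the sets on the left (`H(f) = 2¹⁰·27·H(E_{A,B})`,
  `height_eq_of_invariants_eq`), `PGL₂(ℚ)`-classes preserve `(I,J)`, and each family of classes
  is finite because every `PGL₂(ℚ)`-class is a union of `GL₂(ℤ)`-orbits of irreducible forms of
  nonzero discriminant (`27Δ = 4I³ − J² = −2¹²·27·(4A³+27B²)`), finitely many by the above.

## References

* M. Bhargava, A. Shankar, Ann. of Math. (2) 181 (2015) 191–242 = arXiv:1006.1002, Thm 2.1 and
  §5.4 (proof of Thm 5.14). [cite: BhargavaShankarAnnals2015, §5.4 (arXiv:1006.1002v2 numbering)]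
-/

noncomputable section

open scoped Classical
open Finset

namespace Literature.NumberTheory.EllipticCurves

namespace BinaryQuartic

/-! ## Finiteness of the orbit sets from an asymptotic count -/

/-- The orbit sets `{GL₂(ℤ)f : f ∈ S irreducible, H(f) < X}` increase with `X`. [folklore] -/
theorem orbits_mono (S : Set (BinaryQuartic ℤ)) {X X' : ℝ} (h : X ≤ X') :
    gl2zOrbit '' {f | f ∈ S ∧ f.IsIrreducible ∧ f.height < X} ⊆
      gl2zOrbit '' {f | f ∈ S ∧ f.IsIrreducible ∧ f.height < X'} :=
  Set.image_mono fun _ hf ↦ ⟨hf.1, hf.2.1, hf.2.2.trans_le h⟩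

/-- **An asymptotic `N(S; X) = cX^{5/6} + O(X^a)` (`c > 0`, `a < 5/6`) forces all the orbit sets
to be finite** (an infinite one at `X₀` makes `N(S; X) = 0` — the junk value of `Set.ncard` — for
all `X ≥ X₀`, contradicting the growth `cX^{5/6}`). [folklore] -/
theorem finite_orbits_of_asymptotic {S : Set (BinaryQuartic ℤ)} {c C a : ℝ} (hc : 0 < c)
    (ha : a < 5 / 6)
    (hS : ∀ X : ℝ, 1 ≤ X → |(gl2zClassCount S X : ℝ) - c * X ^ (5 / 6 : ℝ)| ≤ C * X ^ a)
    (Y : ℝ) : (gl2zOrbit '' {f | f ∈ S ∧ f.IsIrreducible ∧ f.height < Y}).Finite := by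
  by_contra hinf
  set δ : ℝ := 5 / 6 - a with hδ
  have hδpos : 0 < δ := by rw [hδ]; linarith
  set M : ℝ := |C| / c + 1 with hM
  have hM1 : 1 ≤ M := by
    rw [hM]; have : 0 ≤ |C| / c := div_nonneg (abs_nonneg C) hc.le; linarith
  set X : ℝ := max (max Y 1) (M ^ (1 / δ)) with hX
  have hX1 : 1 ≤ X := (le_max_right Y 1).trans (le_max_left _ _)
  have hXpos : 0 < X := one_pos.trans_le hX1
  have hYX : Y ≤ X := (le_max_left Y 1).trans (le_max_left _ _)
  -- the orbit set at `X` is infinite, so the count vanishes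
  have hinfX : (gl2zOrbit '' {f | f ∈ S ∧ f.IsIrreducible ∧ f.height < X}).Infinite :=
    fun hfin ↦ hinf (hfin.subset (orbits_mono S hYX))
  have h0 : gl2zClassCount S X = 0 := hinfX.ncard
  have hbound := hS X hX1
  rw [h0, Nat.cast_zero, zero_sub, abs_neg, abs_of_pos (mul_pos hc (Real.rpow_pos_of_pos hXpos _))]
    at hbound
  -- but `c X^{5/6} = c X^δ X^a ≥ c M X^a > |C| X^a ≥ C X^a`
  have hXδ : M ≤ X ^ δ := by
    calc M = (M ^ (1 / δ)) ^ δ := by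
          rw [← Real.rpow_mul (by linarith), one_div_mul_cancel hδpos.ne', Real.rpow_one]
      _ ≤ X ^ δ := Real.rpow_le_rpow (Real.rpow_nonneg (by linarith) _) (le_max_right _ _) hδpos.le
  have hsplit : X ^ (5 / 6 : ℝ) = X ^ δ * X ^ a := by
    rw [← Real.rpow_add hXpos]; congr 1; rw [hδ]; ring
  have hXa : 0 < X ^ a := Real.rpow_pos_of_pos hXpos _
  have : c * X ^ (5 / 6 : ℝ) > C * X ^ a := by
    rw [hsplit, ← mul_assoc]
    have h1 : C ≤ |C| := le_abs_self C
    have h2 : |C| < c * M := by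
      rw [hM, mul_add, mul_div_cancel₀ _ hc.ne', mul_one]; linarith
    have h3 : c * M ≤ c * X ^ δ := mul_le_mul_of_nonneg_left hXδ hc.le
    nlinarith
  linarith

/-- **The orbit sets of `V_ℤ^{(0)}`, `V_ℤ^{(1)}`, `V_ℤ^{(2)}` and `V_ℤ^{(2+)}` are finite**, granted
Thm 2.1 (`bhargavaShankar_classCount`, with `ε = 1/24`). [cite: BhargavaShankarAnnals2015, Thm 2.1] -/
theorem finite_orbits_of_classCount (h16 : bhargavaShankar_classCount) (Y : ℝ) :
    (gl2zOrbit '' {f | f ∈ fourRealRoots ∧ f.IsIrreducible ∧ f.height < Y}).Finite ∧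
    (gl2zOrbit '' {f | f ∈ twoRealRoots ∧ f.IsIrreducible ∧ f.height < Y}).Finite ∧
    (gl2zOrbit '' {f | f ∈ noRealRoots ∧ f.IsIrreducible ∧ f.height < Y}).Finite ∧
    (gl2zOrbit '' {f | f ∈ posDefinite ∧ f.IsIrreducible ∧ f.height < Y}).Finite := by
  obtain ⟨C, hC⟩ := h16 (1 / 24) (by norm_num)
  have hπ : 0 < Real.pi ^ 2 / 6 := by positivity
  have ha : (3 / 4 + 1 / 24 : ℝ) < 5 / 6 := by norm_num
  have h0 := finite_orbits_of_asymptotic (S := fourRealRoots) (c := 4 / 135 * (Real.pi ^ 2 / 6))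
    (C := C) (by positivity) ha (fun X hX ↦ (hC X hX).1) Y
  have h1 := finite_orbits_of_asymptotic (S := twoRealRoots) (c := 32 / 135 * (Real.pi ^ 2 / 6))
    (C := C) (by positivity) ha (fun X hX ↦ (hC X hX).2.1) Y
  have h2 := finite_orbits_of_asymptotic (S := noRealRoots) (c := 8 / 135 * (Real.pi ^ 2 / 6))
    (C := C) (by positivity) ha (fun X hX ↦ (hC X hX).2.2) Y
  refine ⟨h0, h1, h2, h2.subset (Set.image_mono fun f hf ↦ ⟨posDefinite_subset_noRealRoots hf.1, hf.2⟩)⟩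

/-! ## `PGL₂(ℚ)`-classes with prescribed invariants: finiteness -/

/-- The trace on a set `V` of the `PGL₂(ℚ)`-class of an integral form `f` is the union of the
traces of the `GL₂(ℤ)`-orbits it contains; in particular it is determined by the `GL₂(ℤ)`-orbit of
`f` (`GL₂(ℤ)`-equivalent forms are `PGL₂(ℚ)`-equivalent, `GL2ZEquiv.pgl2Equiv_map`).
[cite: BhargavaShankarAnnals2015, §5.2 (PGL₂(ℚ)-orbits as unions of GL₂(ℤ)-orbits; arXiv:1006.1002v2 numbering)] -/
theorem pgl2Trace_eq_of_gl2zOrbit (V : Set (BinaryQuartic ℤ)) (f : BinaryQuartic ℤ) :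
    {g | g ∈ V ∧ PGL2Equiv (f.map (Int.castRingHom ℚ)) (g.map (Int.castRingHom ℚ))} =
      {g | g ∈ V ∧ ∃ f' ∈ gl2zOrbit f, PGL2Equiv (f'.map (Int.castRingHom ℚ)) (g.map (Int.castRingHom ℚ))} := by
  ext g
  simp only [Set.mem_setOf_eq]
  refine and_congr_right fun _ ↦ ⟨fun h ↦ ⟨f, GL2ZEquiv.refl f, h⟩, ?_⟩
  rintro ⟨f', hf', h⟩
  exact (GL2ZEquiv.pgl2Equiv_map hf').trans h

/-- The set of traces on `V` of the `PGL₂(ℚ)`-classes of the elements of `V` is the image of the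
set of `GL₂(ℤ)`-orbits of elements of `V`; hence it is finite when the latter is. [folklore] -/
theorem pgl2Traces_finite_of_orbits_finite (V : Set (BinaryQuartic ℤ))
    (h : (gl2zOrbit '' V).Finite) :
    ((fun f ↦ {g | g ∈ V ∧ PGL2Equiv (f.map (Int.castRingHom ℚ)) (g.map (Int.castRingHom ℚ))}) ''
      V).Finite := by
  have heq : (fun f ↦ {g | g ∈ V ∧ PGL2Equiv (f.map (Int.castRingHom ℚ)) (g.map (Int.castRingHom ℚ))}) '' V =
      (fun O : Set (BinaryQuartic ℤ) ↦ {g | g ∈ V ∧ ∃ f' ∈ O,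
        PGL2Equiv (f'.map (Int.castRingHom ℚ)) (g.map (Int.castRingHom ℚ))}) '' (gl2zOrbit '' V) := by
    rw [Set.image_image]
    exact Set.image_congr fun f _ ↦ pgl2Trace_eq_of_gl2zOrbit V f
  rw [heq]
  exact h.image _

/-- For `(A, B)` in the height family, an integral form with invariants `2⁴(−3A)`, `2⁶(−27B)` has
nonzero discriminant: `27Δ = 4I³ − J² = −2¹²·27·(4A³ + 27B²)`. [folklore] -/
theorem disc_ne_zero_of_invariants {f : BinaryQuartic ℤ} {AB : ℤ × ℤ} (hAB : IsInHeightFamily AB)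
    (hI : f.I = 2 ^ 4 * (-3 * AB.1)) (hJ : f.J = 2 ^ 6 * (-27 * AB.2)) : f.disc ≠ 0 := by
  intro h0
  have h27 := twentySeven_mul_disc f
  rw [h0, mul_zero, hI, hJ] at h27
  apply hAB.1
  nlinarith [h27]

/-- Such a form lies in `V_ℤ^{(0)} ∪ V_ℤ^{(1)} ∪ V_ℤ^{(2)}` (`Δ > 0` definite or not, or `Δ < 0`). [folklore] -/
theorem mem_realTypes_of_disc_ne_zero {f : BinaryQuartic ℤ} (h : f.disc ≠ 0) :
    f ∈ fourRealRoots ∨ f ∈ twoRealRoots ∨ f ∈ noRealRoots := by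
  rcases lt_or_gt_of_ne h with hlt | hgt
  · exact Or.inr (Or.inl hlt)
  · by_cases hdef : (f.map (Int.castRingHom ℝ)).IsDefinite
    · exact Or.inr (Or.inr hdef)
    · exact Or.inl ⟨hgt, hdef⟩

/-- **Finiteness of the `PGL₂(ℚ)`-classes with prescribed invariants** `2⁴(−3A)`, `2⁶(−27B)`,
`(A,B)` in the height family, granted Thm 2.1: such forms are irreducible (by assumption), of
height `2¹⁰·27·H(E_{A,B})` and of nonzero discriminant, so their `GL₂(ℤ)`-orbits are among the
finitely many counted by `N(V_ℤ^{(i)}; 2¹⁰·27·H(E_{A,B}) + 1)`. [cite: BhargavaShankarAnnals2015, Thm 2.1 and §5.4 (arXiv:1006.1002v2 numbering)] -/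
theorem pgl2Traces_finite (h16 : bhargavaShankar_classCount) {AB : ℤ × ℤ} (hAB : IsInHeightFamily AB) :
    ((fun f ↦ {g | g ∈ {f : BinaryQuartic ℤ | f.IsLocallySoluble ∧ f.IsIrreducible ∧
        f.I = 2 ^ 4 * (-3 * AB.1) ∧ f.J = 2 ^ 6 * (-27 * AB.2)} ∧
        PGL2Equiv (f.map (Int.castRingHom ℚ)) (g.map (Int.castRingHom ℚ))}) ''
      {f : BinaryQuartic ℤ | f.IsLocallySoluble ∧ f.IsIrreducible ∧
        f.I = 2 ^ 4 * (-3 * AB.1) ∧ f.J = 2 ^ 6 * (-27 * AB.2)}).Finite := by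
  apply pgl2Traces_finite_of_orbits_finite
  set Y : ℝ := 2 ^ 10 * 27 * (naiveHeight (AB.1, AB.2) : ℝ) + 1 with hY
  obtain ⟨h0, h1, h2, -⟩ := finite_orbits_of_classCount h16 Y
  refine ((h0.union h1).union h2).subset ?_
  rintro _ ⟨f, ⟨-, hirr, hI, hJ⟩, rfl⟩
  have hheight : f.height < Y := by
    rw [hY, height_eq_of_invariants_eq hI hJ]; linarith
  rcases mem_realTypes_of_disc_ne_zero (disc_ne_zero_of_invariants hAB hI hJ) with h | h | h
  · exact Or.inl (Or.inl ⟨f, ⟨h, hirr, hheight⟩, rfl⟩)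
  · exact Or.inl (Or.inr ⟨f, ⟨h, hirr, hheight⟩, rfl⟩)
  · exact Or.inr ⟨f, ⟨h, hirr, hheight⟩, rfl⟩

/-! ## `N(S^F; 2¹⁰·27·X)` as a sum over the curves of height `< X` -/

/-- Membership in the set counted by `N(S^F; 2¹⁰·27·X)`: a locally soluble irreducible form with
invariants `(2⁴I, 2⁶J)`, `(I,J) = (−3A, −27B) ∈ F^{inv}`, and `H(f) < 2¹⁰·27·X` is exactly such a
form attached to a curve `E_{A,B}` of the family with `H(E_{A,B}) < X`
(`H(f) = 2¹⁰·27·H(E_{A,B})`). [cite: BhargavaShankarAnnals2015, §5.4 p. 34 (arXiv:1006.1002v2 numbering)] -/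
theorem mem_locSolIrredSet_iff (X : ℕ) (f : BinaryQuartic ℤ) :
    f ∈ {f : BinaryQuartic ℤ | f.IsLocallySoluble ∧ f.IsIrreducible ∧
        (∃ IJ ∈ invariantPairs, f.I = 2 ^ 4 * IJ.1 ∧ f.J = 2 ^ 6 * IJ.2) ∧
        f.height < 2 ^ 10 * 27 * (X : ℝ)} ↔
      ∃ AB ∈ heightFamilyBelow X, f ∈ {f : BinaryQuartic ℤ | f.IsLocallySoluble ∧ f.IsIrreducible ∧
        f.I = 2 ^ 4 * (-3 * AB.1) ∧ f.J = 2 ^ 6 * (-27 * AB.2)} := by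
  simp only [Set.mem_setOf_eq, mem_invariantPairs_iff, mem_heightFamilyBelow_iff]
  constructor
  · rintro ⟨hls, hirr, ⟨IJ, ⟨AB, hAB, rfl⟩, hI, hJ⟩, hH⟩
    refine ⟨AB, ⟨hAB, ?_⟩, hls, hirr, hI, hJ⟩
    rw [height_eq_of_invariants_eq hI hJ] at hH
    have : (naiveHeight (AB.1, AB.2) : ℝ) < X := by nlinarith
    exact_mod_cast this
  · rintro ⟨AB, ⟨hAB, hH⟩, hls, hirr, hI, hJ⟩
    refine ⟨hls, hirr, ⟨(-3 * AB.1, -27 * AB.2), ⟨AB, hAB, rfl⟩, hI, hJ⟩, ?_⟩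
    rw [height_eq_of_invariants_eq hI hJ]
    have : (naiveHeight (AB.1, AB.2) : ℝ) < X := by exact_mod_cast hH
    nlinarith

/-- `PGL₂(ℚ)`-equivalent integral forms have the same invariants. [cite: BhargavaShankarAnnals2015, §3.3 (arXiv:1006.1002v2 numbering)] -/
theorem invariants_eq_of_pgl2Equiv {f g : BinaryQuartic ℤ}
    (h : PGL2Equiv (f.map (Int.castRingHom ℚ)) (g.map (Int.castRingHom ℚ))) :
    g.I = f.I ∧ g.J = f.J := by
  have hI := h.I_eq
  have hJ := h.J_eq
  rw [I_map, I_map, eq_intCast, eq_intCast] at hI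
  rw [J_map, J_map, eq_intCast, eq_intCast] at hJ
  exact ⟨by exact_mod_cast hI, by exact_mod_cast hJ⟩

/-- The invariants `2⁴(−3A)`, `2⁶(−27B)` determine `(A, B)`. [folklore] -/
theorem eq_of_invariants_eq {AB AB' : ℤ × ℤ} (h1 : (2 : ℤ) ^ 4 * (-3 * AB.1) = 2 ^ 4 * (-3 * AB'.1))
    (h2 : (2 : ℤ) ^ 6 * (-27 * AB.2) = 2 ^ 6 * (-27 * AB'.2)) : AB = AB' :=
  Prod.ext (by linarith) (by linarith)

/-- `Set.ncard` of a finite pairwise disjoint union over a `Finset`. [folklore] -/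
theorem ncard_biUnion_finset {ι α : Type*} (s : Finset ι) (F : ι → Set α)
    (hfin : ∀ i ∈ s, (F i).Finite)
    (hdisj : ∀ i ∈ s, ∀ j ∈ s, i ≠ j → Disjoint (F i) (F j)) :
    (⋃ i ∈ s, F i).ncard = ∑ i ∈ s, (F i).ncard := by
  induction s using Finset.induction_on with
  | empty => simp
  | insert a s ha ih =>
    rw [Finset.set_biUnion_insert, Finset.sum_insert ha,
      Set.ncard_union_eq ?_ (hfin a (mem_insert_self a s)) ?_, ih]
    · exact fun i hi ↦ hfin i (mem_insert_of_mem hi)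
    · exact fun i hi j hj hij ↦ hdisj i (mem_insert_of_mem hi) j (mem_insert_of_mem hj) hij
    · rw [Set.disjoint_left]
      intro t hta htU
      simp only [Set.mem_iUnion] at htU
      obtain ⟨i, hi, hti⟩ := htU
      have hne : a ≠ i := fun h ↦ ha (h ▸ hi)
      exact Set.disjoint_left.mp (hdisj a (mem_insert_self a s) i (mem_insert_of_mem hi) hne) hta hti
    · exact Set.Finite.biUnion s.finite_toSet fun i hi ↦ hfin i (mem_insert_of_mem hi)

/-- **`N(S^F; 2¹⁰·27·X) = Σ_{(A,B) ∈ heightFamilyBelow X} #{PGL₂(ℚ)-classes of locally soluble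
irreducible integral forms with invariants 2⁴(−3A), 2⁶(−27B)}`**, granted Thm 2.1 (for the
finiteness of the class counts): the counted set is the disjoint union over `(A,B)` of the
summands' sets, and `PGL₂(ℚ)`-classes do not mix invariants (Bhargava–Shankar, §5.4, p. 34:
"the numerator … is equal to `N(S^F; 2¹²X)`", in the tree's normalisation
`2¹²H'(E) = 2¹⁰·27·H(E)`). [cite: BhargavaShankarAnnals2015, §5.4 p. 34 (arXiv:1006.1002v2 numbering)] -/
theorem sum_pgl2QClassCount_eq_locSolIrredClassCount (h16 : bhargavaShankar_classCount) (X : ℕ) :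
    ∑ AB ∈ heightFamilyBelow X,
        pgl2QClassCount {f : BinaryQuartic ℤ | f.IsLocallySoluble ∧ f.IsIrreducible ∧
          f.I = 2 ^ 4 * (-3 * AB.1) ∧ f.J = 2 ^ 6 * (-27 * AB.2)} =
      locSolIrredClassCount (2 ^ 10 * 27 * (X : ℝ)) := by
  -- notation
  set ι := Int.castRingHom ℚ
  set S : ℤ × ℤ → Set (BinaryQuartic ℤ) := fun AB ↦ {f : BinaryQuartic ℤ | f.IsLocallySoluble ∧
    f.IsIrreducible ∧ f.I = 2 ^ 4 * (-3 * AB.1) ∧ f.J = 2 ^ 6 * (-27 * AB.2)} with hS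
  set U : Set (BinaryQuartic ℤ) := {f : BinaryQuartic ℤ | f.IsLocallySoluble ∧ f.IsIrreducible ∧
    (∃ IJ ∈ invariantPairs, f.I = 2 ^ 4 * IJ.1 ∧ f.J = 2 ^ 6 * IJ.2) ∧
    f.height < 2 ^ 10 * 27 * (X : ℝ)} with hU
  set T : Set (BinaryQuartic ℤ) → BinaryQuartic ℤ → Set (BinaryQuartic ℤ) :=
    fun V f ↦ {g | g ∈ V ∧ PGL2Equiv (f.map ι) (g.map ι)} with hT
  have hmemU : ∀ f, f ∈ U ↔ ∃ AB ∈ heightFamilyBelow X, f ∈ S AB := mem_locSolIrredSet_iff X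
  -- traces on `U` of forms of `S AB` are traces on `S AB`
  have htrace : ∀ AB ∈ heightFamilyBelow X, ∀ f ∈ S AB, T U f = T (S AB) f := by
    intro AB hAB f hf
    ext g
    simp only [hT, Set.mem_setOf_eq]
    constructor
    · rintro ⟨hgU, hfg⟩
      refine ⟨?_, hfg⟩
      obtain ⟨AB', -, hg'⟩ := (hmemU g).mp hgU
      obtain ⟨hI, hJ⟩ := invariants_eq_of_pgl2Equiv hfg
      have : AB' = AB := eq_of_invariants_eq (by rw [← hg'.2.2.1, hI, hf.2.2.1])
        (by rw [← hg'.2.2.2, hJ, hf.2.2.2])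
      subst this
      exact hg'
    · rintro ⟨hgS, hfg⟩
      exact ⟨(hmemU g).mpr ⟨AB, hAB, hgS⟩, hfg⟩
  -- the set of traces on `U` is the union over `AB` of the sets of traces on `S AB`
  have hunion : T U '' U = ⋃ AB ∈ heightFamilyBelow X, T (S AB) '' S AB := by
    ext t
    simp only [Set.mem_image, Set.mem_iUnion]
    constructor
    · rintro ⟨f, hfU, rfl⟩
      obtain ⟨AB, hAB, hfS⟩ := (hmemU f).mp hfU
      exact ⟨AB, hAB, f, hfS, (htrace AB hAB f hfS).symm⟩
    · rintro ⟨AB, hAB, f, hfS, rfl⟩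
      exact ⟨f, (hmemU f).mpr ⟨AB, hAB, hfS⟩, htrace AB hAB f hfS⟩
  -- these families are pairwise disjoint
  have hdisj : ∀ AB ∈ heightFamilyBelow X, ∀ AB' ∈ heightFamilyBelow X, AB ≠ AB' →
      Disjoint (T (S AB) '' S AB) (T (S AB') '' S AB') := by
    intro AB _ AB' _ hne
    rw [Set.disjoint_left]
    rintro t ⟨f, hf, rfl⟩ ⟨f', hf', ht⟩
    have hff : f ∈ T (S AB') f' := by
      rw [ht]; exact ⟨hf, PGL2Equiv.refl _⟩
    exact hne (eq_of_invariants_eq (by rw [← hf.2.2.1, hff.1.2.2.1]) (by rw [← hf.2.2.2, hff.1.2.2.2]))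
  -- and finite
  have hfin : ∀ AB ∈ heightFamilyBelow X, (T (S AB) '' S AB).Finite := fun AB hAB ↦
    pgl2Traces_finite h16 ((mem_heightFamilyBelow_iff AB X).mp hAB).1
  -- conclude
  show ∑ AB ∈ heightFamilyBelow X, (T (S AB) '' S AB).ncard = (T U '' U).ncard
  rw [hunion, ncard_biUnion_finset _ _ hfin hdisj]

end BinaryQuartic

end Literature.NumberTheory.EllipticCurves

end
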